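import Summits.BirchSwinnertonDyer.BirchSwinnertonDyer.Theorems.SignedLowerHalvesSmallImageLowerHalfBothSignsRttLayerLawUndepleted
import Summits.BirchSwinnertonDyer.BirchSwinnertonDyer.Theorems.SignedLowerHalvesSmallImageLowerHalfBothSignsRttEulerLayer
import Literature.NumberTheory.EllipticCurves.GreenbergVatsal2000.NonPrimitiveSelmerGroup
import Literature.NumberTheory.EllipticCurves.Rank1Residual.Predicates
import HarnessLib

/-!
# Route `SignedLowerHalves`, crux L `SmallImageLowerHalfBothSigns` (item stmt-BirchSwinnertonDyer-23599), line `rtt_w3` v3 —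
# stub AN_W `stub_layerLambdaDepleted_ns`: the W-side DEPLETED LAYER LAW at an odd prime `p`

Width seat `bsd-line-slh-p3-w3` g11 under LEAD `cruxlead-stmt-BirchSwinnertonDyer-23599` g0 (cell `bsd-ssimc`); STUB BRIEF
`BRIEF-AN_W.md` (48f912b935258292). ROUTE-INDEPENDENT helper (`--supports stmt-BirchSwinnertonDyer-23599`); THEOREMS ONLY — no
definition, no named fact, no `sorry`; closes nothing by itself; BSD is not proved by any of this.

THE STATEMENT (v3 stub AN_W, VERBATIM the brief's registered-text-to-be). On the class of crux L (`p` odd, `ClassX7 W p`,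
non-CM, `a_p = 0`, `¬ Surj W p` — all INERT here), for the conductor-level newform `f` of `W`, a Pollack pair `(L⁺, L⁻)` of
`f` at `p` (`IsPollackPair`), a sign `ε` and a finite set `S₀` of places not above `p`: for all `n ≫ 0` of the parity of `ε`,

  `λ_n(θ^{S₀}_n(f)) = λ(L^ε) + Σ_{v∈S₀} δ_W^{(v)} + deg ω_n^{−ε}`,

where `θ^{S₀}_n(f) = (θ_n(f) · ∏_{v∈S₀} P_v(ℓ_v⁻¹ (X+1)^{e_{v,n}})) mod ω_n` is the `S₀`-depleted Mazur–Tate element at layer `n`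
read in `ℚ̄_p[X]` (`e_{v,n} = (−f_ℓ mod pⁿ)`, `f_ℓ` Greenberg–Vatsal's Frobenius exponent), `λ_n` is Pollack–Weston's layer `λ`
(`layerLambda`: least index attaining the Gauss norm), `λ(L^ε) = lam (kobayashiL ε L⁺ L⁻)`, `δ_W^{(v)} = s_ℓ·d_ℓ`
(`GreenbergVatsal2000.delta`), and `ω_n^{−ε} = ω_n^-` for `ε = 1` (even `n`), `ω_n^+` for `ε = −1` (odd `n`).

PROOF (kernel algebra; the `p`-generic port of the tree's `p = 2` theorem `ResidualThetaLayer.stub_analyticLayerLawAtTwo`,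
steps (1)–(6)). (1) `IsPollackPair` at the parity of `ε` gives Pollack's congruence `θ_n ≡ (−1)^{⌊n/2⌋+1} ω_n^{−ε} L^ε (mod ω_n)`;
`ω_n^{−ε} ≡ X^{deg ω_n^{−ε}} (mod p)` (`SmallImageRttOneSided.map_zmod_cyclotomicOmega{Plus,Minus}`, p742508), so the integral-model
lemma `ResidualThetaLayer.exists_integralModel_of_isCongrModOmega` writes `θ_n = p^μ · P`, `P ∈ ℤ_p[X]`,
`ord_X(P̄) = deg ω_n^{−ε} + λ(L^ε)` inside the headroom. (2) The layer Euler factors `E_{v,n} ∈ ℤ_p[X]` have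
`ord_X(Ē_{v,n}) = δ_W^{(v)}` for `n > v_p(f_ℓ)` (`SmallImageRttOneSided.order_layerEulerProduct`, p743580 — Greenberg–Vatsal
Prop. (2.4) at the layers). (3) Orders add in the domain `𝔽_p⟦X⟧`. (4) Reduction modulo `ω_n` over `ℤ_p` is, modulo `p`,
truncation below `pⁿ` (`ω̄_n = X^{pⁿ}`), which keeps an order `< pⁿ` (headroom `deg ω_n^{−ε} + λ(L^ε) + Σδ < pⁿ`, automatic for
`n ≥ 2(λ(L^ε) + Σδ) + 2` by `natDegree_omega_add_lt_pow`). (5) The target polynomial is `p^μ · (PP mod ω_n)^φ` for the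
norm-preserving `φ : ℤ_p → ℚ̄_p`. (6) `layerLambda` of a non-zero constant times the image of an integral polynomial is the
`X`-order of its reduction (`layerLambda_map_eq_of_order`, `layerLambda_C_mul`).

* `layerLambda_depleted_of_isCongrModOmega` — the law at ONE layer from an abstract congruence `θ_n ≡ (−1)^e ω L (mod ω_n)`,
  `ω̄ = X^d`, inside the headroom `d + λ(L) + Σδ < pⁿ` and past the Frobenius thresholds `n > v_p(f_ℓ)` (`v ∈ S₀`).
* `layerLambda_depleted_of_isPollackPair` — the same for a Pollack pair at a layer of the parity of `ε`.
* `eventually_layerLambda_depleted_of_isPollackPair` — the `∃ n₀` form (`n₀ = Σ_{v∈S₀}(v_p(f_ℓ)+1) + 2(λ(L^ε)+Σδ) + 2`).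
* **`stub_layerLambdaDepleted_ns`** — the registered v3 stub text (outer class guards inert; `ℤ`-cast bookkeeping).

References: [Pollack2003] Prop. 6.18, §6.5; [PollackWeston2011MT] §3.1, Thm. 4.1; [GreenbergVatsal2000] §1 (9), §2 Prop. (2.4);
[Kurihara2002]; [Washington1997] §7.1.
-/

set_option autoImplicit false
-- D-0017: single-problem summit, the namespace repeats the problem name by design.
set_option linter.dupNamespace false
noncomputable section

open scoped Classical MatrixGroups ModularForm BigOperators

open CongruenceSubgroup WeierstrassCurve Polynomial NumberField IsDedekindDomain
  Literature.NumberTheory.EllipticCurves Literature.NumberTheory.EllipticCurves.ModularForms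
  Literature.NumberTheory.EllipticCurves.Rank1Residual
  Literature.NumberTheory.EllipticCurves.GreenbergVatsal2000
  Literature.NumberTheory.IwasawaTheory Rat.HeightOneSpectrum
  Summit.BirchSwinnertonDyer.Rank1Residual.Supersingular
  Summit.BirchSwinnertonDyer.Rank1Residual.X1.MuLambda
  Summit.BirchSwinnertonDyer.Rank1Residual.X2.EulerFactorInvariants
  Summit.BirchSwinnertonDyer.BirchSwinnertonDyer.Theorems.ResidualThetaLayer
  Summit.BirchSwinnertonDyer.BirchSwinnertonDyer.Theorems.SmallImageRttOneSided

namespace Summit.BirchSwinnertonDyer.BirchSwinnertonDyer.Theorems.SmallImageRttLayerLaw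

/-! ## §1 The depleted layer law at one layer, from a congruence mod `ω_n` -/

section OneLayer

variable (W : WeierstrassCurve ℚ) {p : ℕ} [hp : Fact p.Prime]

/-- **The depleted layer law at ONE layer from a congruence** (odd `p`). If `θ_n(f) ≡ (−1)^e ω L (mod ω_n)` in `Λ ⊗ ℚ_p`
(`IsCongrModOmega`), `ω ≡ X^d (mod p)`, `L ≠ 0`, `S₀` is a finite set of places `v = (ℓ)` with `ℓ ≠ p`, `n > v_p(f_ℓ)` for all
`v ∈ S₀`, and `d + λ(L) + Σ_{v∈S₀} δ_W^{(v)} < pⁿ`, then the layer-`λ` of the `S₀`-depleted element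
`(θ_n(f) · ∏_{v∈S₀} P_v(ℓ⁻¹(X+1)^{e_{v,n}})) mod ω_n`, read in `ℚ̄_p[X]`, is `d + λ(L) + Σ_{v∈S₀} δ_W^{(v)}`.
[cite: Pollack2003, Prop. 6.18 and Prop. 6.9] [cite: PollackWeston2011MT, §3.1] [cite: GreenbergVatsal2000, §2 Prop. (2.4) and §1 (9)] -/
theorem layerLambda_depleted_of_isCongrModOmega (hp2 : p ≠ 2) {N : ℕ} (f : CuspForm (Gamma0 N) 2)
    {n : ℕ} {ω : ℤ[X]} {d : ℕ} (hω : ω.map (Int.castRingHom (ZMod p)) = X ^ d) (e : ℕ)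
    {L : IwasawaAlgebra p} (hL : L ≠ 0) (hcong : IsCongrModOmega p n (mazurTateElement f p n) ((-1) ^ e * ω) L)
    (S₀ : Finset (HeightOneSpectrum (𝓞 ℚ))) (hS : ∀ v ∈ S₀, natGenerator v ≠ p)
    (hfrob : ∀ v ∈ S₀, (frobeniusExponent p (natGenerator v : ℤ_[p])).valuation < n)
    (hroom : d + lam L + ∑ v ∈ S₀, delta W p v < p ^ n) :
    layerLambda (((mazurTateElement f p n).map (algebraMap ℚ (PadicAlgCl p)) *
        ∏ v ∈ S₀, ((W.localPolynomialAt v).map (Int.castRingHom (PadicAlgCl p))).comp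
          (C ((natGenerator v : PadicAlgCl p)⁻¹) *
            (X + 1) ^ (PadicInt.toZModPow n (-(frobeniusExponent p (natGenerator v : ℤ_[p])))).val)) %ₘ
        ((X + 1) ^ p ^ n - 1)) =
      d + lam L + ∑ v ∈ S₀, delta W p v := by
  -- notation
  set φ : ℤ_[p] →+* PadicAlgCl p := (algebraMap ℚ_[p] (PadicAlgCl p)).comp (algebraMap ℤ_[p] ℚ_[p])
    with hφdef
  have hφ : ∀ x, ‖φ x‖ = ‖x‖ := norm_algebraMap_comp_padicInt
  set Sδ : ℕ := ∑ v ∈ S₀, delta W p v with hSδ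
  have hp0 : (p : PadicAlgCl p) ≠ 0 := by exact_mod_cast hp.out.ne_zero
  have hn0 : 0 < p ^ n := pow_pos hp.out.pos n
  -- (1) the Mazur–Tate side: `θ_n = p^μ · P`, `ord_X(P̄) = d + lam L`
  have hωu := map_zmod_neg_one_pow_mul hω e
  have hu : ((-1 : ZMod p) ^ e) ≠ 0 := pow_ne_zero _ (neg_ne_zero.mpr one_ne_zero)
  have hθcoeff : ∀ i, p ^ n ≤ i → (mazurTateElement f p n).coeff i = 0 := fun i hi ↦
    coeff_eq_zero_of_natDegree_lt (lt_of_lt_of_le (natDegree_mazurTateElement_lt f p n) hi)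
  have hd' : d + lam L < p ^ n := by omega
  obtain ⟨P, μ, hθP, hordP⟩ := exists_integralModel_of_isCongrModOmega hcong hL hθcoeff hωu hu hd'
  -- (2) the Euler side (Greenberg–Vatsal Prop. (2.4) at the layers, odd `p`)
  have hordE := order_layerEulerProduct W hp2 S₀ hS hfrob
  -- (3) the product `PP = P · ∏ E_v` in `ℤ_p[X]` and its order mod `p`
  set E : HeightOneSpectrum (𝓞 ℚ) → ℤ_[p][X] := fun v ↦
    ((W.localPolynomialAt v).map (Int.castRingHom ℤ_[p])).comp
      (C ((natGenerator v : ℤ_[p]).inv) *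
        (X + 1) ^ (PadicInt.toZModPow n (-(frobeniusExponent p (natGenerator v : ℤ_[p])))).val) with hE
  set PP : ℤ_[p][X] := P * ∏ v ∈ S₀, E v with hPP
  have hordPP : ((PP.map (PadicInt.toZMod (p := p)) : (ZMod p)[X]) : PowerSeries (ZMod p)).order =
      ((d + lam L + Sδ : ℕ) : ℕ∞) := by
    rw [hPP, Polynomial.map_mul, Polynomial.coe_mul, PowerSeries.order_mul, hordP, hordE, ← Nat.cast_add]
  -- (4) reduction modulo `ω_n` over `ℤ_p`
  set ωZ : ℤ_[p][X] := (X + 1) ^ p ^ n - 1 with hωZ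
  have hωZmonic : ωZ.Monic := by
    have h1 : (X + 1 : ℤ_[p][X]).Monic := by rw [← C_1]; exact monic_X_add_C 1
    have hm : ((X + 1 : ℤ_[p][X]) ^ p ^ n).Monic := h1.pow _
    refine hm.sub_of_left ?_
    have hdeg : (X + 1 : ℤ_[p][X]).natDegree = 1 := by rw [← C_1, natDegree_X_add_C]
    rw [degree_one, degree_eq_natDegree hm.ne_zero, h1.natDegree_pow, hdeg, mul_one]
    exact_mod_cast hn0
  set R : ℤ_[p][X] := PP %ₘ ωZ with hR
  have hordR : ((R.map (PadicInt.toZMod (p := p)) : (ZMod p)[X]) : PowerSeries (ZMod p)).order =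
      ((d + lam L + Sδ : ℕ) : ℕ∞) := by
    rw [hR, Polynomial.map_modByMonic _ hωZmonic, hωZ, Polynomial.map_sub, Polynomial.map_pow,
      Polynomial.map_add, Polynomial.map_X, Polynomial.map_one, X_add_one_pow_prime_pow_sub_one p n]
    exact order_coe_modByMonic_X_pow _ hordPP (by omega)
  have hlayer := (layerLambda_map_eq_of_order φ hφ hordR).1
  -- (5) the target polynomial is `p^μ · R.map φ`
  have hφint : φ.comp (Int.castRingHom ℤ_[p]) = Int.castRingHom (PadicAlgCl p) := RingHom.ext_int _ _
  have hφrat : (algebraMap ℚ_[p] (PadicAlgCl p)).comp (algebraMap ℚ ℚ_[p]) = algebraMap ℚ (PadicAlgCl p) :=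
    RingHom.ext_rat _ _
  have hφinv : ∀ v ∈ S₀, φ ((natGenerator v : ℤ_[p]).inv) = ((natGenerator v : PadicAlgCl p))⁻¹ := by
    intro v hv
    obtain ⟨hcop, -⟩ := coprime_natGenerator v (p := p) (hS v hv)
    have hnorm : ‖(natGenerator v : ℤ_[p])‖ = 1 := PadicInt.norm_natCast_eq_one_iff.mpr hcop
    have hmul : φ (natGenerator v : ℤ_[p]) * φ ((natGenerator v : ℤ_[p]).inv) = 1 := by
      rw [← map_mul, PadicInt.mul_inv hnorm, map_one]
    rw [map_natCast] at hmul
    exact eq_inv_of_mul_eq_one_right hmul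
  have hEmap : ∀ v ∈ S₀, (E v).map φ =
      ((W.localPolynomialAt v).map (Int.castRingHom (PadicAlgCl p))).comp
        (C ((natGenerator v : PadicAlgCl p)⁻¹) *
          (X + 1) ^ (PadicInt.toZModPow n (-(frobeniusExponent p (natGenerator v : ℤ_[p])))).val) := by
    intro v hv
    rw [hE, Polynomial.map_comp, Polynomial.map_map, hφint, Polynomial.map_mul, Polynomial.map_C, hφinv v hv,
      Polynomial.map_pow, Polynomial.map_add, Polynomial.map_X, Polynomial.map_one]
  have hθmap : (mazurTateElement f p n).map (algebraMap ℚ (PadicAlgCl p)) =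
      C ((p : PadicAlgCl p) ^ μ) * P.map φ := by
    rw [← hφrat, ← Polynomial.map_map, hθP, Polynomial.map_mul, Polynomial.map_C, map_pow, map_natCast,
      Polynomial.map_map]
  have htarget : ((mazurTateElement f p n).map (algebraMap ℚ (PadicAlgCl p)) *
        ∏ v ∈ S₀, ((W.localPolynomialAt v).map (Int.castRingHom (PadicAlgCl p))).comp
          (C ((natGenerator v : PadicAlgCl p)⁻¹) *
            (X + 1) ^ (PadicInt.toZModPow n (-(frobeniusExponent p (natGenerator v : ℤ_[p])))).val)) %ₘ
        ((X + 1) ^ p ^ n - 1) =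
      C ((p : PadicAlgCl p) ^ μ) * R.map φ := by
    have hprod : ∏ v ∈ S₀, ((W.localPolynomialAt v).map (Int.castRingHom (PadicAlgCl p))).comp
          (C ((natGenerator v : PadicAlgCl p)⁻¹) *
            (X + 1) ^ (PadicInt.toZModPow n (-(frobeniusExponent p (natGenerator v : ℤ_[p])))).val) =
        (∏ v ∈ S₀, E v).map φ := by
      rw [Polynomial.map_prod]
      exact Finset.prod_congr rfl fun v hv ↦ (hEmap v hv).symm
    have hωmap : ((X + 1 : (PadicAlgCl p)[X]) ^ p ^ n - 1) = ωZ.map φ := by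
      rw [hωZ, Polynomial.map_sub, Polynomial.map_pow, Polynomial.map_add, Polynomial.map_X, Polynomial.map_one]
    rw [hθmap, hprod, mul_assoc, ← Polynomial.map_mul, ← hPP, hωmap, C_mul', smul_modByMonic,
      ← Polynomial.map_modByMonic φ hωZmonic, ← hR, ← C_mul']
  -- (6) conclude
  have hpμ : ((p : PadicAlgCl p) ^ μ) ≠ 0 := pow_ne_zero _ hp0
  rw [htarget, layerLambda_C_mul hpμ, hlayer]

/-- **The depleted layer law at a layer of the parity of `ε`, for a Pollack pair** (odd `p`): for a weight-2 cusp form `f` on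
`Γ₀(N)` with `IsPollackPair f p L⁺ L⁻`, a sign `ε` (`ε = 1` ↔ even `n` ↔ `L^ε = L⁻`, `ω_n^{−ε} = ω_n^-`; `ε = −1` ↔ odd `n` ↔
`L⁺`, `ω_n^+`), a finite `S₀` of places `≠ p`, and a layer `n` with `Even n ↔ ε = 1`, `n > v_p(f_ℓ)` (`v ∈ S₀`) and
`deg ω_n^{−ε} + λ(L^ε) + Σδ < pⁿ`: `λ_n(θ^{S₀}_n(f)) = deg ω_n^{−ε} + λ(L^ε) + Σ_{v∈S₀} δ_W^{(v)}`.
[cite: Pollack2003, Prop. 6.18] [cite: PollackWeston2011MT, Thm. 4.1] [cite: GreenbergVatsal2000, §2 Prop. (2.4) and §1 (9)] -/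
theorem layerLambda_depleted_of_isPollackPair (hp2 : p ≠ 2) {N : ℕ} (f : CuspForm (Gamma0 N) 2)
    {Lplus Lminus : IwasawaAlgebra p} (hPP : IsPollackPair f p Lplus Lminus) (ε : ℤˣ)
    (S₀ : Finset (HeightOneSpectrum (𝓞 ℚ))) (hS : ∀ v ∈ S₀, natGenerator v ≠ p) {n : ℕ}
    (hpar : Even n ↔ ε = 1)
    (hfrob : ∀ v ∈ S₀, (frobeniusExponent p (natGenerator v : ℤ_[p])).valuation < n)
    (hroom : (if ε = 1 then cyclotomicOmegaMinus p n else cyclotomicOmegaPlus p n).natDegree +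
      lam (kobayashiL ε Lplus Lminus) + ∑ v ∈ S₀, delta W p v < p ^ n) :
    layerLambda (((mazurTateElement f p n).map (algebraMap ℚ (PadicAlgCl p)) *
        ∏ v ∈ S₀, ((W.localPolynomialAt v).map (Int.castRingHom (PadicAlgCl p))).comp
          (C ((natGenerator v : PadicAlgCl p)⁻¹) *
            (X + 1) ^ (PadicInt.toZModPow n (-(frobeniusExponent p (natGenerator v : ℤ_[p])))).val)) %ₘ
        ((X + 1) ^ p ^ n - 1)) =
      (if ε = 1 then cyclotomicOmegaMinus p n else cyclotomicOmegaPlus p n).natDegree +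
        lam (kobayashiL ε Lplus Lminus) + ∑ v ∈ S₀, delta W p v := by
  rcases Int.units_eq_one_or ε with rfl | rfl
  · -- `ε = 1`: even layers, `ω_n^-`, `L⁻`
    have heven : Even n := hpar.mpr rfl
    simp only [if_true, kobayashiL] at hroom ⊢
    exact layerLambda_depleted_of_isCongrModOmega W hp2 f (map_zmod_cyclotomicOmegaMinus n) (n / 2 + 1)
      hPP.2.1 (hPP.2.2.2 n heven) S₀ hS hfrob hroom
  · -- `ε = −1`: odd layers, `ω_n^+`, `L⁺`
    have hne : (-1 : ℤˣ) ≠ 1 := by decide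
    have hodd : Odd n := Nat.not_even_iff_odd.mp fun h ↦ hne (hpar.mp h)
    simp only [hne, if_false, kobayashiL] at hroom ⊢
    exact layerLambda_depleted_of_isCongrModOmega W hp2 f (map_zmod_cyclotomicOmegaPlus n) (n / 2 + 1)
      hPP.1 (hPP.2.2.1 n hodd) S₀ hS hfrob hroom

/-- **The depleted layer law, eventually** (odd `p`): with `n₀ = Σ_{v∈S₀}(v_p(f_ℓ) + 1) + 2(λ(L^ε) + Σδ) + 2`, for every
`n ≥ n₀` of the parity of `ε`, `λ_n(θ^{S₀}_n(f)) = deg ω_n^{−ε} + λ(L^ε) + Σ_{v∈S₀} δ_W^{(v)}` (the Frobenius thresholds hold and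
the headroom is `natDegree_omega_add_lt_pow`). [cite: Pollack2003, Prop. 6.18] [cite: PollackWeston2011MT, Thm. 4.1]
[cite: GreenbergVatsal2000, §2 Prop. (2.4) and §1 (9)] -/
theorem eventually_layerLambda_depleted_of_isPollackPair (hp2 : p ≠ 2) {N : ℕ} (f : CuspForm (Gamma0 N) 2)
    {Lplus Lminus : IwasawaAlgebra p} (hPP : IsPollackPair f p Lplus Lminus) (ε : ℤˣ)
    (S₀ : Finset (HeightOneSpectrum (𝓞 ℚ))) (hS : ∀ v ∈ S₀, natGenerator v ≠ p) :
    ∃ n₀ : ℕ, ∀ n ≥ n₀, (Even n ↔ ε = 1) →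
      layerLambda (((mazurTateElement f p n).map (algebraMap ℚ (PadicAlgCl p)) *
          ∏ v ∈ S₀, ((W.localPolynomialAt v).map (Int.castRingHom (PadicAlgCl p))).comp
            (C ((natGenerator v : PadicAlgCl p)⁻¹) *
              (X + 1) ^ (PadicInt.toZModPow n (-(frobeniusExponent p (natGenerator v : ℤ_[p])))).val)) %ₘ
          ((X + 1) ^ p ^ n - 1)) =
        (if ε = 1 then cyclotomicOmegaMinus p n else cyclotomicOmegaPlus p n).natDegree +
          lam (kobayashiL ε Lplus Lminus) + ∑ v ∈ S₀, delta W p v := by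
  set t : HeightOneSpectrum (𝓞 ℚ) → ℕ := fun v ↦ (frobeniusExponent p (natGenerator v : ℤ_[p])).valuation with ht
  set B : ℕ := lam (kobayashiL ε Lplus Lminus) + ∑ v ∈ S₀, delta W p v with hB
  refine ⟨(∑ v ∈ S₀, (t v + 1)) + (2 * B + 2), fun n hn hpar ↦ ?_⟩
  have htn : ∀ v ∈ S₀, t v < n := fun v hv ↦ by
    have := Finset.single_le_sum (f := fun w ↦ t w + 1) (fun _ _ ↦ Nat.zero_le _) hv
    omega
  have hroom := natDegree_omega_add_lt_pow (p := p) (B := B) (n := n) (by omega) ε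
  exact layerLambda_depleted_of_isPollackPair W hp2 f hPP ε S₀ hS hpar htn (by rw [hB] at hroom; omega)

end OneLayer

/-! ## §2 The registered stub AN_W -/

section Stub

/-- **Stub AN_W `stub_layerLambdaDepleted_ns` of line `rtt_w3` (v3), VERBATIM the registered text**: on the class of crux L
(`p` odd, `ClassX7`, non-CM, `a_p = 0`, `¬ Surj` — inert), for the newform `f` of `W`, every Pollack pair `(L⁺, L⁻)` at `p`, every
sign `ε` and every finite `S₀ ∌ p`: for all `n ≫ 0` of the parity of `ε`,
`λ_n(θ^{S₀}_n(f)) = λ(L^ε) + Σ_{v∈S₀} δ_W^{(v)} + deg ω_n^{−ε}` (as integers). See the module docstring for the proof.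
[cite: Pollack2003, Prop. 6.18] [cite: PollackWeston2011MT, §3.1 and Thm. 4.1] [cite: GreenbergVatsal2000, §2 Prop. (2.4) and §1 (9)] -/
theorem stub_layerLambdaDepleted_ns : ∀ (W : WeierstrassCurve ℚ) [W.IsElliptic] [W.IsGloballyMinimal] (p : ℕ) [Fact p.Prime],
      p ≠ 2 → ClassX7 W p → ¬ W.HasCM → W.frobeniusTrace p = 0 → ¬ Surj W p →
      ∀ (ε : ℤˣ), ∀ [NeZero (W.conductorNorm ℤ)] (f : CuspForm (Gamma0 (W.conductorNorm ℤ)) 2), IsNewformOf W f →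
        ∀ (Lplus Lminus : IwasawaAlgebra p), IsPollackPair f p Lplus Lminus →
        ∀ (S₀ : Finset (HeightOneSpectrum (𝓞 ℚ))), (∀ v ∈ S₀, ((p : ℕ) : 𝓞 ℚ) ∉ v.asIdeal) →
        ∃ n₀ : ℕ, ∀ n ≥ n₀, (Even n ↔ ε = 1) →
          ((layerLambda (((mazurTateElement f p n).map (algebraMap ℚ (PadicAlgCl p)) *
              ∏ v ∈ S₀, ((W.localPolynomialAt v).map (Int.castRingHom (PadicAlgCl p))).comp
                (C ((natGenerator v : PadicAlgCl p)⁻¹) *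
                  (X + 1) ^ (PadicInt.toZModPow n (-(frobeniusExponent p (natGenerator v : ℤ_[p])))).val)) %ₘ
              ((X + 1) ^ p ^ n - 1)) : ℕ) : ℤ) =
            ((lam (kobayashiL ε Lplus Lminus) : ℕ) : ℤ) + ((∑ v ∈ S₀, delta W p v : ℕ) : ℤ) +
              ((if ε = 1 then cyclotomicOmegaMinus p n else cyclotomicOmegaPlus p n).natDegree : ℤ) := by
  intro W _ _ p _ hp2 _ _ _ _ ε _ f _ Lplus Lminus hPP S₀ hS₀
  have hS : ∀ v ∈ S₀, natGenerator v ≠ p := fun v hv ↦ natGenerator_ne_of_natCast_not_mem v (hS₀ v hv)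
  obtain ⟨n₀, hn₀⟩ := eventually_layerLambda_depleted_of_isPollackPair W hp2 f hPP ε S₀ hS
  refine ⟨n₀, fun n hn hpar ↦ ?_⟩
  rw [hn₀ n hn hpar]
  push_cast
  ring

end Stub

end Summit.BirchSwinnertonDyer.BirchSwinnertonDyer.Theorems.SmallImageRttLayerLaw

end
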